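import Summits.KontsevichZagierPeriods.KontsevichZagierPeriods.Theorems.SymplecticScissorsPlanarCompilerStubCellCompiler
import Summits.KontsevichZagierPeriods.KontsevichZagierPeriods.Theorems.SymplecticScissorsPlanarCompilerStubNormalForm
import Summits.KontsevichZagierPeriods.KontsevichZagierPeriods.Theorems.SymplecticScissorsPlanarCompilerStubElementaryMoves
import Summits.KontsevichZagierPeriods.KontsevichZagierPeriods.Theorems.SymplecticScissorsPlanarCompilerStubShearedTransport
import Summits.KontsevichZagierPeriods.KontsevichZagierPeriods.Theorems.SymplecticScissorsPlanarCompilerStubSignedSweep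
import Summits.KontsevichZagierPeriods.KontsevichZagierPeriods.Theorems.SymplecticScissorsPlanarCompilerStubBand
import Summits.KontsevichZagierPeriods.KontsevichZagierPeriods.Theorems.SymplecticScissorsPlanarCompilerGreenAux5

/-!
# `PlanarCompiler` (crux stmt-KontsevichZagierPeriods-10058, route SymplecticScissors) — the compiler theorem (closes the crux)

Line `twist-restoring-shear` (crux protocol, lead prover), reshaped at L1 with the SAME composition
idea (Θ = cell compiler; normal form; Θ kills 1a/1b/2; Green by the inverse-function-theorem engine on
sign cells): the twist parameter is fixed to `λ = 0` and flat cells (`∂_bA = 0`) are a third cell type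
that needs no transport, which removes the "generic λ" step of the planner's `stub_genericShear`;
the planner's `stub_greenSignedBands` is split into `stub_signedSweep` (geometry), `stub_band` (one
cell) and `stub_greenAssembly` (bookkeeping, held by the lead). `PlanarCompiler_of` below composes the
seven stubs and concludes the crux BY NAME; all seven stubs are landed Theorems files (imported above); this file is sorry-free and closes the crux.

Conventions: `G` = the planar set-chain group
`closure((domainAddRel ∪ changeOfVariablesRel) ∩ closure{[s] : s planar, integrand 1})`, written out
in every signature (registered stubs carry no local definitions); `Δ` the closed and `T` the open
standard triangle; `Ψ₁ = fun p => ![p 0, A p]`, `Ψ₂ = fun p => ![p 1, B p]`.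
-/

noncomputable section

open MeasureTheory Set
open Literature.NumberTheory.Transcendental Literature.ModelTheory.ExponentialFields
open Summit.KontsevichZagierPeriods.KontsevichZagierPeriods.Theses.SymplecticScissors

namespace Summit.KontsevichZagierPeriods.SymplecticScissors.PlanarCompilerProof

-- stub_cellCompiler: Summits.KontsevichZagierPeriods.KontsevichZagierPeriods.Theorems.SymplecticScissorsPlanarCompilerStubCellCompiler
-- stub_normalForm: Summits.KontsevichZagierPeriods.KontsevichZagierPeriods.Theorems.SymplecticScissorsPlanarCompilerStubNormalForm
-- stub_elementaryMoves: Summits.KontsevichZagierPeriods.KontsevichZagierPeriods.Theorems.SymplecticScissorsPlanarCompilerStubElementaryMoves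
-- stub_shearedTransport: Summits.KontsevichZagierPeriods.KontsevichZagierPeriods.Theorems.SymplecticScissorsPlanarCompilerStubShearedTransport
-- stub_signedSweep: Summits.KontsevichZagierPeriods.KontsevichZagierPeriods.Theorems.SymplecticScissorsPlanarCompilerStubSignedSweep
-- stub_band: Summits.KontsevichZagierPeriods.KontsevichZagierPeriods.Theorems.SymplecticScissorsPlanarCompilerStubBand
-- stub_greenAssembly: Summits.KontsevichZagierPeriods.KontsevichZagierPeriods.Theorems.SymplecticScissorsPlanarCompilerGreenAux5

/-- **The compiler.** `RealOnePeriodRelations → PlanarK0Injective`: normalise both regions to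
`Θ`-images of 1-dimensional combinations `c, c'` (stub 2), feed the vanishing combination `c − c'`
to the antecedent, and push the resulting certificate through `Θ` by closure induction — the
elementary moves by stub 3, the Green generator by stubs 4–7. -/
theorem PlanarCompiler_of : PlanarCompiler := by
  intro hR r r' hr hr' hval
  obtain ⟨Θ, hΘ⟩ := stub_cellCompiler
  have hmoves := stub_elementaryMoves Θ hΘ
  obtain ⟨c, hc, hce, hcr⟩ := stub_normalForm Θ hΘ r hr
  obtain ⟨c', hc', hce', hcr'⟩ := stub_normalForm Θ hΘ r' hr'
  have hcc' : c - c' ∈ AddSubgroup.closure (Set.range fun ρ : KZ.IntegralRep 1 => KZ.of ρ) :=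
    sub_mem hc hc'
  have heval : KZ.eval (c - c') = 0 := by rw [map_sub, hce, hce', hval, sub_self]
  have hgen := hR (c - c') hcc' heval
  have hΘG : Θ (c - c') ∈ AddSubgroup.closure ((KZ.domainAddRel ∪ KZ.changeOfVariablesRel) ∩ (AddSubgroup.closure {x : KZ.FormalRep | ∃ s : KZ.IntegralRep 2, (∀ p ∈ s.domain, s.integrand p = 1) ∧ x = KZ.of s} : Set KZ.FormalRep)) := by
    refine AddSubgroup.closure_induction (fun x hx => ?_) ?_ (fun x y _ _ hx hy => ?_)
      (fun x _ hx => ?_) hgen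
    · rcases hx with hx | hx
      · exact hmoves x hx
      · obtain ⟨Δ', A, B, S, r₀₁, r₁₂, r₀₂, hΔ, hA, hB, hAc, hBc, hS, h1, h2, h3, h4, h5, h6, rfl⟩ := hx
        subst hΔ
        exact stub_greenAssembly Θ hΘ hmoves stub_shearedTransport stub_band stub_signedSweep A B S hA hB
          hAc hBc hS r₀₁ r₁₂ r₀₂ h1 h2 h3 h4 h5 h6
    · simp only [map_zero]; exact zero_mem _
    · simp only [map_add]; exact add_mem hx hy
    · simp only [map_neg]; exact neg_mem hx
  have hsplit : KZ.of r - KZ.of r' = (KZ.of r - Θ c) + Θ (c - c') - (KZ.of r' - Θ c') := by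
    rw [map_sub]; abel
  rw [hsplit]
  exact sub_mem (add_mem hcr hΘG) hcr'

/-- The crux `PlanarCompiler` of route SymplecticScissors (alias of `PlanarCompiler_of`, the name used by
`ledger workitem release --by`). [Kontsevich–Zagier 2001, §1.2] -/
theorem PlanarCompiler_proof : PlanarCompiler := PlanarCompiler_of

end Summit.KontsevichZagierPeriods.SymplecticScissors.PlanarCompilerProof
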